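import Mathlib
import Summits.Ventures.PercRepro2.SwOutMixedArmsFace

/-!
# The several-arms big-block lemma on the face `f = ⊥`: the overlap lemmas (blind cell PercRepro2, night-4 g20,
2026-08-27; proofs/NIGHT4-G20.md §4)

The lemmas about the overlap of the core cube with the slab cubes, for the theorem
`face_empty_card_le` of `SwOutMixedArmsBase`.  The pieces: the core cube and the `2^R` slab cubes (`SwOutMixedArmsFace`), the slab cube of `A`
meeting the core cube in the antipodal pair `oPt A = F(⊤, 1_A)`, `obPt A = F(⊥, 1_{Aᶜ})`.  TWO
GLOBAL CASES decide where the overlaps are counted.  If `F(⊥, ⊤) ∈ Q` (then every `obPt A ∈ Q`):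
the core piece `SA` is all of `Core(Q)`, and the slab piece `SB A` is the slab points of index `A`
minus `{oPt A, obPt A}` — an antipodal pair when `oPt A ∈ Q` (its hits cancel), the maximal point
`obPt A` otherwise (the only point above it, the top `tPt A`, is above `oPt A`).  If
`F(⊥, ⊤) ∉ Q`: no top `tPt A` lies in `Q` (it would force `F(⊥, ⊤)`), so every `obPt A` is
maximal in its slab piece and is removed there, while the core piece loses its whole `s = ⊤`
slice (every point above an `s = ⊤` core point is an `s = ⊤` core point).  The cube principle on
every piece and the counts add.
-/

namespace Summit.Ventures.PercRepro2

namespace MixedArms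

open scoped Classical

variable {ι ρ ν κ : Type*}

section Overlap

variable [DecidableEq ρ] {arm : ν → ρ} {A : Finset ρ}

/-- The slab cube of `A` at `y = true`, in tuple form. -/
lemma tbA_eq_of_true {y : Config (CubeA arm A)} (hy : y (Sum.inl ()) = true) :
    (tbA arm A y : PtR ι ρ ν κ) =
      ((fun _ => true), (fun i => if h : arm i ∈ A then true else y (Sum.inr (Sum.inl ⟨i, h⟩))),
        (fun r => if r ∈ A then true else false),
        (fun r => if h : r ∈ A then true else y (Sum.inr (Sum.inr ⟨r, h⟩))), fun _ => false) := by
  simp only [tbA, hy, Bool.not_true]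

/-- The slab cube of `A` at `y = false`, in tuple form. -/
lemma tbA_eq_of_false {y : Config (CubeA arm A)} (hy : y (Sum.inl ()) = false) :
    (tbA arm A y : PtR ι ρ ν κ) =
      ((fun _ => false), (fun i => if h : arm i ∈ A then false else y (Sum.inr (Sum.inl ⟨i, h⟩))),
        (fun r => if r ∈ A then false else true),
        (fun r => if h : r ∈ A then false else y (Sum.inr (Sum.inr ⟨r, h⟩))), fun _ => false) := by
  simp only [tbA, hy, Bool.not_false]

/-- Within a slab, the slab cube is monotone. -/
lemma tbA_le_tbA_of_eq {y y' : Config (CubeA arm A)} (h : y (Sum.inl ()) = y' (Sum.inl ()))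
    (hle : y ≤ y') : (tbA arm A y : PtR ι ρ ν κ) ≤ tbA arm A y' := by
  refine ⟨fun _ => hle _, fun i => ?_, fun r => ?_, fun r => ?_, fun _ => le_rfl⟩
  · simp only [tbA]
    split_ifs
    · exact hle _
    · exact hle _
  · simp only [tbA, h, le_refl]
  · simp only [tbA]
    split_ifs
    · exact hle _
    · exact hle _

variable {Q : Set (PtR ι ρ ν κ)}

/-- Lowerness along a slab cube: below a point of `Q` in the slab cube of `A`, the cube stays in
`Q` (the raw order within a slab; across the slabs: lower the attached arms to dropped-red, apply
`G5`, lower again). -/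
lemma tbA_mem_of_le (hQ : IsLowerSet Q) (hG : G5 Q) {y y' : Config (CubeA arm A)}
    (hle : y ≤ y') (hy' : (tbA arm A y' : PtR ι ρ ν κ) ∈ Q) :
    (tbA arm A y : PtR ι ρ ν κ) ∈ Q := by
  cases h0 : y (Sum.inl ()) <;> cases h0' : y' (Sum.inl ())
  · exact hQ (tbA_le_tbA_of_eq (h0.trans h0'.symm) hle) hy'
  · rw [tbA_eq_of_true h0'] at hy'
    set p1 : PtR ι ρ ν κ := ((fun _ => true), (fun i => if h : arm i ∈ A then true else
        y' (Sum.inr (Sum.inl ⟨i, h⟩))), (fun _ => false),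
        (fun r => if h : r ∈ A then true else y' (Sum.inr (Sum.inr ⟨r, h⟩))),
        fun _ => false) with hp1
    have hle1 : p1 ≤ ((fun _ => true), (fun i => if h : arm i ∈ A then true else
        y' (Sum.inr (Sum.inl ⟨i, h⟩))), (fun r => if r ∈ A then true else false),
        (fun r => if h : r ∈ A then true else y' (Sum.inr (Sum.inr ⟨r, h⟩))),
        fun _ => false) := by
      refine ⟨le_rfl, le_rfl, fun r => ?_, le_rfl, le_rfl⟩
      dsimp only [hp1]
      exact Bool.false_le _
    have h1 : p1 ∈ Q := hQ hle1 hy'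
    have h2 := hG _ _ _ h1
    have hle2 : (tbA arm A y : PtR ι ρ ν κ) ≤ ((fun _ => false), (fun i => if h : arm i ∈ A then
        true else y' (Sum.inr (Sum.inl ⟨i, h⟩))), (fun _ => true),
        (fun r => if h : r ∈ A then true else y' (Sum.inr (Sum.inr ⟨r, h⟩))), fun _ => false) := by
      rw [tbA_eq_of_false h0]
      refine ⟨le_rfl, fun i => ?_, fun r => ?_, fun r => ?_, le_rfl⟩
      · dsimp only
        split_ifs
        · exact Bool.false_le _
        · exact hle _
      · dsimp only
        exact Bool.le_true _
      · dsimp only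
        split_ifs
        · exact Bool.false_le _
        · exact hle _
    exact hQ hle2 h2
  · have := hle (Sum.inl ())
    rw [h0, h0'] at this
    exact absurd (MixedPieces.true_le_imp this rfl) Bool.false_ne_true
  · exact hQ (tbA_le_tbA_of_eq (h0.trans h0'.symm) hle) hy'

/-- `oPt A` lies below the top `tPt A`. -/
lemma oPt_le_tPt : (oPt arm A : PtR ι ρ ν κ) ≤ tPt arm A := by
  refine ⟨le_rfl, fun i => ?_, le_rfl, fun r => ?_, le_rfl⟩
  · simp only [oPt, tPt, tbA, Sum.elim_inl, Sum.elim_inr]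
    split_ifs <;> simp
  · simp only [oPt, tPt, tbA, Sum.elim_inl, Sum.elim_inr]
    split_ifs <;> simp

/-- `obPt A` lies below `F(⊥, ⊤)`. -/
lemma obPt_le_bPt : (obPt arm A : PtR ι ρ ν κ) ≤ bPt := by
  refine ⟨le_rfl, fun i => ?_, fun r => ?_, fun r => ?_, le_rfl⟩
  · simp only [obPt, bPt, tbA, Sum.elim_inl, Sum.elim_inr]
    split_ifs <;> simp
  · simp only [obPt, bPt, tbA, Sum.elim_inl, Sum.elim_inr]
    split_ifs <;> simp
  · simp only [obPt, bPt, tbA, Sum.elim_inl, Sum.elim_inr]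
    split_ifs <;> simp

/-- The top of a slab cube in `Q` forces `F(⊥, ⊤) ∈ Q`: drop every arm, apply `G5`. -/
lemma bPt_mem_of_tPt_mem (hQ : IsLowerSet Q) (hG : G5 Q) (h : (tPt arm A : PtR ι ρ ν κ) ∈ Q) :
    (bPt : PtR ι ρ ν κ) ∈ Q := by
  have hle1 : (((fun _ => true), (fun _ => true), (fun _ => false), (fun _ => true),
      fun _ => false) : PtR ι ρ ν κ) ≤ tPt arm A := by
    simp only [tPt, tbA]
    refine ⟨le_rfl, fun i => ?_, fun r => ?_, fun r => ?_, le_rfl⟩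
    · dsimp only
      split_ifs <;> simp
    · dsimp only
      split_ifs <;> simp
    · dsimp only
      split_ifs <;> simp
  exact hG _ _ _ (hQ hle1 h)

/-- `oPt A` is a core point with all u-arms red. -/
lemma core_oPt : Core (oPt arm A : PtR ι ρ ν κ) arm := by
  refine ⟨fun i => ?_, fun r => ?_⟩
  · simp only [oPt, tbA, Sum.elim_inl, Sum.elim_inr]
    split_ifs <;> rfl
  · simp only [oPt, tbA, Sum.elim_inl, Sum.elim_inr]
    split_ifs <;> rfl

/-- `obPt A` is a core point with all u-arms blue. -/
lemma core_obPt : Core (obPt arm A : PtR ι ρ ν κ) arm := by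
  refine ⟨fun i => ?_, fun r => ?_⟩
  · simp only [obPt, tbA, Sum.elim_inl, Sum.elim_inr]
    split_ifs <;> rfl
  · simp only [obPt, tbA, Sum.elim_inl, Sum.elim_inr]
    split_ifs <;> rfl

/-- The u-arms of `oPt A` are red. -/
lemma oPt_fst : (oPt arm A : PtR ι ρ ν κ).1 = fun _ => true := rfl

/-- The u-arms of `obPt A` are blue. -/
lemma obPt_fst : (obPt arm A : PtR ι ρ ν κ).1 = fun _ => false := rfl

/-- The partial flip exchanges `oPt A` and `obPt A`. -/
lemma flipT_empty_oPt [DecidableEq κ] : flipT ∅ (oPt arm A : PtR ι ρ ν κ) = obPt arm A := by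
  rw [oPt, flipT_empty_tbA]
  congr 1
  funext t
  rcases t with ⟨⟨⟩⟩ | t <;> rfl

/-- The partial flip exchanges `obPt A` and `oPt A`. -/
lemma flipT_empty_obPt [DecidableEq κ] : flipT ∅ (obPt arm A : PtR ι ρ ν κ) = oPt arm A := by
  rw [obPt, flipT_empty_tbA]
  congr 1
  funext t
  rcases t with ⟨⟨⟩⟩ | t <;> rfl

/-- A core point of the face with all u-arms red is `oPt` of its index. -/
lemma eq_oPt_of_core_top [Nonempty ι] [Fintype ρ] {p : PtR ι ρ ν κ} (hc : Core p arm)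
    (hs : p.1 = fun _ => true) (hf : p ∈ face ∅) : p = oPt arm (idxA p) := by
  obtain ⟨s, a, uP, e, f⟩ := p
  obtain ⟨ha, hu⟩ := hc
  simp only at ha hu hs
  have hy : y0 ((s, a, uP, e, f) : PtR ι ρ ν κ) = true := by simp only [y0, hs]
  have hA : ∀ r, r ∈ idxA ((s, a, uP, e, f) : PtR ι ρ ν κ) ↔ uP r = true := by
    intro r
    rw [idxA, Finset.mem_filter, hy]
    simp only [Finset.mem_univ, true_and]
  simp only [oPt, tbA, Sum.elim_inl, Sum.elim_inr]
  refine Prod.ext hs (Prod.ext ?_ (Prod.ext ?_ (Prod.ext ?_ ?_)))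
  · funext i
    dsimp only
    rw [ha i]
    split_ifs with h
    · exact (hA _).1 h
    · cases hu' : uP (arm i)
      · rfl
      · exact absurd ((hA _).2 hu') h
  · funext r
    dsimp only
    split_ifs with h
    · exact (hA _).1 h
    · cases hu' : uP r
      · rfl
      · exact absurd ((hA _).2 hu') h
  · funext r
    dsimp only
    rw [← hu r]
    split_ifs with h
    · exact (hA _).1 h
    · cases hu' : uP r
      · rfl
      · exact absurd ((hA _).2 hu') h
  · funext k
    exact hf k (Finset.notMem_empty k)

/-- A core point of the face with all u-arms blue is `obPt` of its index. -/
lemma eq_obPt_of_core_bot [Nonempty ι] [Fintype ρ] {p : PtR ι ρ ν κ} (hc : Core p arm)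
    (hs : p.1 = fun _ => false) (hf : p ∈ face ∅) : p = obPt arm (idxA p) := by
  obtain ⟨s, a, uP, e, f⟩ := p
  obtain ⟨ha, hu⟩ := hc
  simp only at ha hu hs
  have hy : y0 ((s, a, uP, e, f) : PtR ι ρ ν κ) = false := by simp only [y0, hs]
  have hA : ∀ r, r ∈ idxA ((s, a, uP, e, f) : PtR ι ρ ν κ) ↔ uP r = false := by
    intro r
    rw [idxA, Finset.mem_filter, hy]
    simp only [Finset.mem_univ, true_and]
  simp only [obPt, tbA, Sum.elim_inl, Sum.elim_inr]
  refine Prod.ext hs (Prod.ext ?_ (Prod.ext ?_ (Prod.ext ?_ ?_)))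
  · funext i
    dsimp only
    rw [ha i]
    split_ifs with h
    · exact (hA _).1 h
    · cases hu' : uP (arm i)
      · exact absurd ((hA _).2 hu') h
      · rfl
  · funext r
    dsimp only
    split_ifs with h
    · exact (hA _).1 h
    · cases hu' : uP r
      · exact absurd ((hA _).2 hu') h
      · rfl
  · funext r
    dsimp only
    rw [← hu r]
    split_ifs with h
    · exact (hA _).1 h
    · cases hu' : uP r
      · exact absurd ((hA _).2 hu') h
      · rfl
  · funext k
    exact hf k (Finset.notMem_empty k)

omit [DecidableEq ρ] in
/-- A core point with all u-arms red is a T-slab point. -/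
lemma tslab_of_core_top {p : PtR ι ρ ν κ} (hc : Core p arm) (hs : p.1 = fun _ => true) :
    TSlab p arm := by
  refine ⟨hs, fun r => ?_⟩
  cases hu : p.2.2.1 r
  · exact Or.inl rfl
  · right
    refine ⟨fun i hi => ?_, ?_⟩
    · rw [hc.1 i, hi, hu]
    · rw [← hc.2 r, hu]

omit [DecidableEq ρ] in
/-- A core point with all u-arms blue is a B-slab point. -/
lemma bslab_of_core_bot {p : PtR ι ρ ν κ} (hc : Core p arm) (hs : p.1 = fun _ => false) :
    BSlab p arm := by
  refine ⟨hs, fun r => ?_⟩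
  cases hu : p.2.2.1 r
  · right
    refine ⟨fun i hi => ?_, ?_⟩
    · rw [hc.1 i, hi, hu]
    · rw [← hc.2 r, hu]
  · exact Or.inl rfl

/-- The index of `oPt A` is `A`. -/
lemma idxA_oPt [Nonempty ι] [Fintype ρ] : idxA (oPt arm A : PtR ι ρ ν κ) = A := idxA_tbA _

/-- The index of `obPt A` is `A`. -/
lemma idxA_obPt [Nonempty ι] [Fintype ρ] : idxA (obPt arm A : PtR ι ρ ν κ) = A := idxA_tbA _

end Overlap

end MixedArms

end Summit.Ventures.PercRepro2
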